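import Literature.MathematicalPhysics.QuantumFieldTheory.BalabanImbrieJaffe1984to88.BIJ88Sect5Statements
import Literature.NumberTheory.LFunctions.HalfIsolatedZeroDerivBounds

/-!
# `BalabanImbrieJaffe1984to88.BIJ88CutoffProfileWitness` — T. Bałaban, J. Imbrie, A. Jaffe, *Effective action and cluster properties
of the abelian Higgs model*, Commun. Math. Phys. **114** (1988) 257–315 [BalabanImbrieJaffe1988]: **(5.2.3)** p. 278 [PDF 22], verbatim
*"We let χ(1,x) be an even, C^∞ function, equal to zero for |x| ≥ 1, and equal to one for |x| ≤ 9/10, and with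
|dⁿχ(1,x)/dxⁿ| ≤ cⁿn^{cn} for all n, x. (5.2.3)"* — the NON-VACUITY of these printed properties.

statement-level skeleton of published theorems with citation tags; proofs where landed; nothing here is a claim about the Yang–Mills mass gap

WHAT THIS FILE ADDS.  The typed carrier `BIJ88Sect5Statements.CutoffProfile` (r18/r16, row C2.Eq5.2.1-5.2.4) records the four printed
properties of χ(1,·) as the fields of a structure and says in its docstring: *"an explicit hypothesis carrier: the existence of such a
profile, a Gevrey-class bump function, is NOT asserted here"*.  The derivative condition `|χ^{(n)}| ≤ cⁿn^{cn}` with ONE constant `c` for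
ALL orders is a genuine restriction (a Gevrey-class condition: for a generic `C^∞` bump the sup norms of the derivatives may grow faster
than any `cⁿn^{cn}`), and every theorem of the skeleton quantifying over `χ : CutoffProfile` (the characteristic functions (5.2.2), the
restrictions (5.9.x), the p. 308–309 interpolation χ′_{Λ,t}, …) is only as good as the existence of one such χ.  We CONSTRUCT one:

* `gevreyCutoff : CutoffProfile` (`cutoffProfile_nonempty : Nonempty CutoffProfile`) with profile
  `chi1 x = S(x) + S(−x) − 1`, `S(x) = H(10(1 − x))` (`step`), where `H = MaynardPratt.w0Step` is the `C^∞` monotone step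
  `H(y) = (∫₀^y h)/C`, `h(x) = e^{−1/(x(1−x))}` on `(0,1)` (else `0`), `C = ∫₀¹ h`, of `Literature/NumberTheory/LFunctions/HalfIsolatedZero.lean`
  — REUSED, not re-declared: its Gevrey-2 derivative bound `|h^{(m)}(x)| ≤ m!(3m/e)ᵐ` is PROVED in
  `Literature/NumberTheory/LFunctions/HalfIsolatedZeroDerivBounds.lean` (`MaynardPratt.norm_iteratedDeriv_w0Core_le`, Cauchy's estimate for
  the holomorphic extension), together with `H^{(k+1)} = h^{(k)}/C` (`MaynardPratt.iteratedDeriv_succ_w0Step`).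
* the printed properties, PROVED: `chi1_neg` (even), `contDiff_chi1` (C^∞), `chi1_eq_zero` (`|x| ≥ 1`), `chi1_eq_one` (`|x| ≤ 9/10`),
  and the Gevrey bound `chi1_deriv_bound : ∃ c, ∀ n x, |chi1^{(n)}(x)| ≤ cⁿ·n^{cn}` with the EXPLICIT constant `c = 30(2/C + 1)`
  (`abs_iteratedDeriv_succ_chi1_le`: `|chi1^{(k+1)}| ≤ 2·10^{k+1}k!(3k/e)ᵏ/C`, then `k!(3k/e)ᵏ ≤ 3^{k+1}(k+1)^{2(k+1)}`); also
  `0 ≤ chi1 ≤ 1` (`chi1_nonneg`, `chi1_le_one`) and the derivative formula `iteratedDeriv_succ_chi1`.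

Nothing here modifies `CutoffProfile` or any statement of the skeleton; the paper's "(say)" profile is of course not unique, and no
claim is made that this χ is the authors' choice — only that the printed requirements (5.2.3) are simultaneously satisfiable.

PDF held: `paper:balaban1988-cmp114-bij-abelian-higgs-effective-action` (journal page = PDF page + 256); p. 278 [PDF 22] (the sentence is
reproduced verbatim in `BIJ88Sect5Statements`).

CITATION HEADER (lean-in-tree rule).  Part of the lit-balaban TYPED SKELETON (HOME `run/shared/lean/pub/lit-balaban/`), Phase 2,
seat p36 (gen 7, unit `lit-balaban-p36`); row **C2.Eq5.2.1-5.2.4** of `HOME/lit-balaban-r16/ROWS-C2-part2.md` (owner r16), member (5.2.3);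
the typed decl of record `BIJ88Sect5Statements.CutoffProfile` is NOT modified.  Definitions with bodies (`step`, `chi1`, `gevreyCutoff`)
and theorems; no `Prop` facts; axioms standard.
-/

noncomputable section

open Literature.NumberTheory.LFunctions.MaynardPratt
open Literature.MathematicalPhysics.QuantumFieldTheory.BalabanImbrieJaffe1984to88.BIJ88Sect5Statements (CutoffProfile cutoff)
open scoped Nat

namespace Literature.MathematicalPhysics.QuantumFieldTheory.BalabanImbrieJaffe1984to88.BIJ88CutoffProfileWitness

/-! ## §1 The one-sided step `S(x) = H(10(1 − x))` -/

/-- The one-sided `C^∞` step `S(x) = H(10(1 − x))`: equal to `1` for `x ≤ 9/10`, to `0` for `x ≥ 1`, values in `[0,1]`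
(`H = MaynardPratt.w0Step`, the normalized primitive of the Gevrey-2 bump `e^{−1/(y(1−y))}`). [cite: BalabanImbrieJaffe1988, (5.2.3) p.278] -/
def step (x : ℝ) : ℝ :=
  w0Step (10 * (1 - x))

/-- `S(x) = 1` for `x ≤ 9/10` (there `10(1 − x) ≥ 1`). [cite: BalabanImbrieJaffe1988, (5.2.3) p.278] -/
theorem step_of_le {x : ℝ} (hx : x ≤ 9 / 10) : step x = 1 :=
  w0Step_of_one_le (by linarith)

/-- `S(x) = 0` for `x ≥ 1` (there `10(1 − x) ≤ 0`). [cite: BalabanImbrieJaffe1988, (5.2.3) p.278] -/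
theorem step_of_one_le {x : ℝ} (hx : 1 ≤ x) : step x = 0 :=
  w0Step_of_nonpos (by linarith)

/-- `0 ≤ S`. [cite: BalabanImbrieJaffe1988, (5.2.3) p.278] -/
theorem step_nonneg (x : ℝ) : 0 ≤ step x :=
  w0Step_nonneg _

/-- `S ≤ 1`. [cite: BalabanImbrieJaffe1988, (5.2.3) p.278] -/
theorem step_le_one (x : ℝ) : step x ≤ 1 :=
  w0Step_le_one _

/-- `S` is `C^∞`. [cite: BalabanImbrieJaffe1988, (5.2.3) p.278] -/
theorem contDiff_step {n : ℕ∞} : ContDiff ℝ n step :=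
  contDiff_w0Step.comp (by fun_prop)

/-- The derivatives of `S`: `S^{(k+1)}(x) = (−10)^{k+1}·h^{(k)}(10(1 − x))/C` (chain rule for the affine map and `H′ = h/C`).
[cite: BalabanImbrieJaffe1988, (5.2.3) p.278] -/
theorem iteratedDeriv_succ_step (k : ℕ) (x : ℝ) :
    iteratedDeriv (k + 1) step x = (-10) ^ (k + 1) * (iteratedDeriv k w0Core (10 * (1 - x)) / w0Const) := by
  have hg : ContDiff ℝ ((k + 1 : ℕ) : ℕ∞) (fun y : ℝ => w0Step (10 - y)) := contDiff_w0Step.comp (by fun_prop)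
  have hstep : step = fun x => (fun y : ℝ => w0Step (10 - y)) (10 * x) := by
    funext x; simp only [step]; ring_nf
  have h := congrFun (iteratedDeriv_comp_const_mul (n := k + 1) (f := fun y : ℝ => w0Step (10 - y)) (by exact_mod_cast hg) 10) x
  rw [hstep, h, iteratedDeriv_comp_const_sub, iteratedDeriv_succ_w0Step]
  beta_reduce
  rw [smul_eq_mul, neg_pow (10 : ℝ) (k + 1), show (10 : ℝ) - 10 * x = 10 * (1 - x) by ring]
  ring

/-- `|S^{(k+1)}(x)| ≤ 10^{k+1}·k!(3k/e)ᵏ/C` (the Gevrey-2 bound `|h^{(k)}| ≤ k!(3k/e)ᵏ` of `MaynardPratt.norm_iteratedDeriv_w0Core_le`).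
[cite: BalabanImbrieJaffe1988, (5.2.3) p.278] -/
theorem abs_iteratedDeriv_succ_step_le (k : ℕ) (x : ℝ) :
    |iteratedDeriv (k + 1) step x| ≤ 10 ^ (k + 1) * (k ! * (3 * k / Real.exp 1) ^ k) / w0Const := by
  rw [iteratedDeriv_succ_step, abs_mul, abs_pow, abs_neg, abs_of_pos (by norm_num : (0 : ℝ) < 10), abs_div,
    abs_of_pos w0Const_pos, mul_div_assoc]
  have h := norm_iteratedDeriv_w0Core_le k (10 * (1 - x))
  rw [Real.norm_eq_abs] at h
  exact mul_le_mul_of_nonneg_left (div_le_div_of_nonneg_right h w0Const_pos.le) (pow_nonneg (by norm_num) _)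

/-! ## §2 The profile `χ(1, x) = S(x) + S(−x) − 1` -/

/-- **The profile** `χ(1,x) = S(x) + S(−x) − 1`: for `x ≥ 0` it is `S(x)` (as `S(−x) = 1`), for `x ≤ 0` it is `S(−x)`.
[cite: BalabanImbrieJaffe1988, (5.2.3) p.278] -/
def chi1 (x : ℝ) : ℝ :=
  step x + step (-x) - 1

/-- *"even"*: `χ(1,−x) = χ(1,x)`. [cite: BalabanImbrieJaffe1988, (5.2.3) p.278] -/
theorem chi1_neg (x : ℝ) : chi1 (-x) = chi1 x := by
  simp only [chi1, neg_neg]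
  ring

/-- For `x ≥ 0`: `χ(1,x) = S(x)`. [cite: BalabanImbrieJaffe1988, (5.2.3) p.278] -/
theorem chi1_of_nonneg {x : ℝ} (hx : 0 ≤ x) : chi1 x = step x := by
  rw [chi1, step_of_le (show -x ≤ 9 / 10 by linarith)]
  ring

/-- For `x ≤ 0`: `χ(1,x) = S(−x)`. [cite: BalabanImbrieJaffe1988, (5.2.3) p.278] -/
theorem chi1_of_nonpos {x : ℝ} (hx : x ≤ 0) : chi1 x = step (-x) := by
  rw [chi1, step_of_le (show x ≤ 9 / 10 by linarith)]
  ring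

/-- *"equal to one for |x| ≤ 9/10"*. [cite: BalabanImbrieJaffe1988, (5.2.3) p.278] -/
theorem chi1_eq_one {x : ℝ} (hx : |x| ≤ 9 / 10) : chi1 x = 1 := by
  rw [abs_le] at hx
  rw [chi1, step_of_le hx.2, step_of_le (show -x ≤ 9 / 10 by linarith)]
  ring

/-- *"equal to zero for |x| ≥ 1"*. [cite: BalabanImbrieJaffe1988, (5.2.3) p.278] -/
theorem chi1_eq_zero {x : ℝ} (hx : 1 ≤ |x|) : chi1 x = 0 := by
  rcases le_or_gt 0 x with h | h
  · rw [abs_of_nonneg h] at hx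
    rw [chi1_of_nonneg h, step_of_one_le hx]
  · rw [abs_of_neg h] at hx
    rw [chi1_of_nonpos h.le, step_of_one_le hx]

/-- `0 ≤ χ(1,x)`. [cite: BalabanImbrieJaffe1988, (5.2.3) p.278] -/
theorem chi1_nonneg (x : ℝ) : 0 ≤ chi1 x := by
  rcases le_or_gt 0 x with h | h
  · rw [chi1_of_nonneg h]; exact step_nonneg x
  · rw [chi1_of_nonpos h.le]; exact step_nonneg (-x)

/-- `χ(1,x) ≤ 1`. [cite: BalabanImbrieJaffe1988, (5.2.3) p.278] -/
theorem chi1_le_one (x : ℝ) : chi1 x ≤ 1 := by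
  rcases le_or_gt 0 x with h | h
  · rw [chi1_of_nonneg h]; exact step_le_one x
  · rw [chi1_of_nonpos h.le]; exact step_le_one (-x)

/-- `|χ(1,x)| ≤ 1` ((5.2.3) at `n = 0`). [cite: BalabanImbrieJaffe1988, (5.2.3) p.278] -/
theorem abs_chi1_le_one (x : ℝ) : |chi1 x| ≤ 1 :=
  abs_le.mpr ⟨by linarith [chi1_nonneg x], chi1_le_one x⟩

/-- *"C^∞"*. [cite: BalabanImbrieJaffe1988, (5.2.3) p.278] -/
theorem contDiff_chi1 {n : ℕ∞} : ContDiff ℝ n chi1 := by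
  have h : ContDiff ℝ n (fun x => step x + step (-x) - 1) :=
    (contDiff_step.add (contDiff_step.comp contDiff_neg)).sub contDiff_const
  exact h

/-- The derivatives of the profile: `χ^{(k+1)}(1,x) = S^{(k+1)}(x) + (−1)^{k+1}S^{(k+1)}(−x)`.
[cite: BalabanImbrieJaffe1988, (5.2.3) p.278] -/
theorem iteratedDeriv_succ_chi1 (k : ℕ) (x : ℝ) :
    iteratedDeriv (k + 1) chi1 x = iteratedDeriv (k + 1) step x + (-1) ^ (k + 1) * iteratedDeriv (k + 1) step (-x) := by
  have h1 : ContDiff ℝ ((k + 1 : ℕ) : ℕ∞) step := contDiff_step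
  have h2 : ContDiff ℝ ((k + 1 : ℕ) : ℕ∞) (fun x : ℝ => step (-x)) := contDiff_step.comp contDiff_neg
  have h3 : ContDiff ℝ ((k + 1 : ℕ) : ℕ∞) (fun _ : ℝ => (1 : ℝ)) := contDiff_const
  have hchi : chi1 = (step + fun x : ℝ => step (-x)) - fun _ : ℝ => (1 : ℝ) := by
    funext x; simp [chi1]
  rw [hchi, iteratedDeriv_sub (by exact_mod_cast (h1.add h2).contDiffAt) (by exact_mod_cast h3.contDiffAt),
    iteratedDeriv_add (by exact_mod_cast h1.contDiffAt) (by exact_mod_cast h2.contDiffAt), iteratedDeriv_const,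
    if_neg (Nat.succ_ne_zero k), sub_zero, iteratedDeriv_comp_neg, smul_eq_mul]

/-- `|χ^{(k+1)}(1,x)| ≤ 2·10^{k+1}·k!(3k/e)ᵏ/C`. [cite: BalabanImbrieJaffe1988, (5.2.3) p.278] -/
theorem abs_iteratedDeriv_succ_chi1_le (k : ℕ) (x : ℝ) :
    |iteratedDeriv (k + 1) chi1 x| ≤ 2 * (10 ^ (k + 1) * (k ! * (3 * k / Real.exp 1) ^ k) / w0Const) := by
  rw [iteratedDeriv_succ_chi1, two_mul]
  refine (abs_add_le _ _).trans (add_le_add (abs_iteratedDeriv_succ_step_le k x) ?_)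
  rw [abs_mul, abs_pow, abs_neg, abs_one, one_pow, one_mul]
  exact abs_iteratedDeriv_succ_step_le k (-x)

/-! ## §3 The Gevrey bound in the printed form `cⁿ n^{cn}` -/

/-- Elementary: `k!(3k/e)ᵏ ≤ 3^{k+1}(k+1)^{2(k+1)}` (`k! ≤ kᵏ`, `e ≥ 1`). [folklore] -/
private theorem factorial_mul_pow_le (k : ℕ) :
    (k ! : ℝ) * (3 * k / Real.exp 1) ^ k ≤ 3 ^ (k + 1) * ((k + 1 : ℕ) : ℝ) ^ (2 * (k + 1)) := by
  have hk1 : (k : ℝ) ≤ (k + 1 : ℕ) := by exact_mod_cast Nat.le_succ k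
  have hK1 : (1 : ℝ) ≤ (k + 1 : ℕ) := by exact_mod_cast Nat.succ_le_succ (Nat.zero_le k)
  have hfac : (k ! : ℝ) ≤ ((k + 1 : ℕ) : ℝ) ^ (k + 1) := by
    calc (k ! : ℝ) ≤ (k : ℝ) ^ k := by exact_mod_cast Nat.factorial_le_pow k
      _ ≤ ((k + 1 : ℕ) : ℝ) ^ k := pow_le_pow_left₀ (Nat.cast_nonneg k) hk1 k
      _ ≤ ((k + 1 : ℕ) : ℝ) ^ (k + 1) := pow_le_pow_right₀ hK1 (Nat.le_succ k)
  have he : (3 : ℝ) * k / Real.exp 1 ≤ 3 * (k + 1 : ℕ) := by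
    have h1 : (1 : ℝ) ≤ Real.exp 1 := Real.one_le_exp zero_le_one
    have h3k : (0 : ℝ) ≤ 3 * k := by positivity
    calc (3 : ℝ) * k / Real.exp 1 ≤ 3 * k := div_le_self h3k h1
      _ ≤ 3 * (k + 1 : ℕ) := by linarith
  have hpow : ((3 : ℝ) * k / Real.exp 1) ^ k ≤ (3 : ℝ) ^ (k + 1) * ((k + 1 : ℕ) : ℝ) ^ (k + 1) := by
    calc ((3 : ℝ) * k / Real.exp 1) ^ k ≤ ((3 : ℝ) * (k + 1 : ℕ)) ^ k := pow_le_pow_left₀ (by positivity) he k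
      _ ≤ ((3 : ℝ) * (k + 1 : ℕ)) ^ (k + 1) := pow_le_pow_right₀ (by linarith) (Nat.le_succ k)
      _ = (3 : ℝ) ^ (k + 1) * ((k + 1 : ℕ) : ℝ) ^ (k + 1) := mul_pow _ _ _
  calc (k ! : ℝ) * (3 * k / Real.exp 1) ^ k ≤ ((k + 1 : ℕ) : ℝ) ^ (k + 1) * ((3 : ℝ) ^ (k + 1) * ((k + 1 : ℕ) : ℝ) ^ (k + 1)) :=
        mul_le_mul hfac hpow (by positivity) (by positivity)
    _ = 3 ^ (k + 1) * ((k + 1 : ℕ) : ℝ) ^ (2 * (k + 1)) := by ring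

/-- `|χ^{(n)}(1,x)| ≤ (2/C)·30ⁿ·n^{2n}` for `n ≥ 1`. [cite: BalabanImbrieJaffe1988, (5.2.3) p.278] -/
theorem abs_iteratedDeriv_succ_chi1_le' (k : ℕ) (x : ℝ) :
    |iteratedDeriv (k + 1) chi1 x| ≤ 2 / w0Const * 30 ^ (k + 1) * ((k + 1 : ℕ) : ℝ) ^ (2 * (k + 1)) := by
  refine (abs_iteratedDeriv_succ_chi1_le k x).trans ?_
  have hC := w0Const_pos
  calc 2 * (10 ^ (k + 1) * ((k ! : ℝ) * (3 * k / Real.exp 1) ^ k) / w0Const)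
      = 2 / w0Const * 10 ^ (k + 1) * ((k ! : ℝ) * (3 * k / Real.exp 1) ^ k) := by
        field_simp
    _ ≤ 2 / w0Const * 10 ^ (k + 1) * (3 ^ (k + 1) * ((k + 1 : ℕ) : ℝ) ^ (2 * (k + 1))) :=
        mul_le_mul_of_nonneg_left (factorial_mul_pow_le k) (by positivity)
    _ = 2 / w0Const * 30 ^ (k + 1) * ((k + 1 : ℕ) : ℝ) ^ (2 * (k + 1)) := by
        rw [show (30 : ℝ) ^ (k + 1) = 10 ^ (k + 1) * 3 ^ (k + 1) by rw [← mul_pow]; norm_num]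
        ring

/-- **(5.2.3), the derivative condition, for this profile**: *"|dⁿχ(1,x)/dxⁿ| ≤ cⁿn^{cn} for all n, x"* with the explicit constant
`c = 30(2/C + 1)`, `C = ∫₀¹ e^{−1/(y(1−y))}dy` (`MaynardPratt.w0Const`). [cite: BalabanImbrieJaffe1988, (5.2.3) p.278] -/
theorem chi1_deriv_bound :
    ∃ c : ℝ, ∀ (n : ℕ) (x : ℝ), |iteratedDeriv n chi1 x| ≤ c ^ n * (n : ℝ) ^ (c * n) := by
  have hC := w0Const_pos
  refine ⟨30 * (2 / w0Const + 1), fun n x => ?_⟩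
  rcases n with _ | k
  · simp only [iteratedDeriv_zero, pow_zero, Nat.cast_zero, mul_zero, Real.rpow_zero, mul_one]
    exact abs_chi1_le_one x
  · refine (abs_iteratedDeriv_succ_chi1_le' k x).trans ?_
    have hK1 : (1 : ℝ) ≤ (k + 1 : ℕ) := by exact_mod_cast Nat.succ_le_succ (Nat.zero_le k)
    have hq : (1 : ℝ) ≤ 2 / w0Const + 1 := by
      have : 0 ≤ 2 / w0Const := by positivity
      linarith
    -- the constant: 2/C · 30ⁿ ≤ (30(2/C+1))ⁿ
    have hconst : 2 / w0Const * (30 : ℝ) ^ (k + 1) ≤ (30 * (2 / w0Const + 1)) ^ (k + 1) := by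
      rw [mul_pow, mul_comm]
      refine mul_le_mul_of_nonneg_left ?_ (by positivity)
      calc 2 / w0Const ≤ 2 / w0Const + 1 := by linarith
        _ ≤ (2 / w0Const + 1) ^ (k + 1) := le_self_pow₀ hq (Nat.succ_ne_zero k)
    -- the power of n: n^{2n} ≤ n^{cn}
    have hexp : ((k + 1 : ℕ) : ℝ) ^ (2 * (k + 1)) ≤ ((k + 1 : ℕ) : ℝ) ^ (30 * (2 / w0Const + 1) * ((k + 1 : ℕ) : ℝ)) := by
      rw [← Real.rpow_natCast]
      refine Real.rpow_le_rpow_of_exponent_le hK1 ?_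
      have h30 : (2 : ℝ) ≤ 30 * (2 / w0Const + 1) := by nlinarith
      have hk0 : (0 : ℝ) ≤ ((k + 1 : ℕ) : ℝ) := Nat.cast_nonneg _
      push_cast
      nlinarith
    calc 2 / w0Const * 30 ^ (k + 1) * ((k + 1 : ℕ) : ℝ) ^ (2 * (k + 1))
        ≤ (30 * (2 / w0Const + 1)) ^ (k + 1) * ((k + 1 : ℕ) : ℝ) ^ (30 * (2 / w0Const + 1) * ((k + 1 : ℕ) : ℝ)) :=
          mul_le_mul hconst hexp (by positivity) (by positivity)
      _ = (30 * (2 / w0Const + 1)) ^ (k + 1) * ((k + 1 : ℕ) : ℝ) ^ (30 * (2 / w0Const + 1) * ((k + 1 : ℕ) : ℝ)) := rfl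

/-! ## §4 The witness -/

/-- **A profile with all the printed properties (5.2.3)** — the structure `CutoffProfile` is inhabited: `χ(1,·) = chi1`, even, `C^∞`,
`= 0` for `|x| ≥ 1`, `= 1` for `|x| ≤ 9/10`, `|χ^{(n)}| ≤ cⁿn^{cn}` with `c = 30(2/C+1)`. [cite: BalabanImbrieJaffe1988, (5.2.3) p.278] -/
def gevreyCutoff : CutoffProfile where
  χ₁ := chi1
  even := chi1_neg
  smooth := contDiff_chi1
  eq_zero := fun _ hx => chi1_eq_zero hx
  eq_one := fun _ hx => chi1_eq_one hx
  deriv_bound := chi1_deriv_bound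

/-- `gevreyCutoff.χ₁ = chi1`. [cite: BalabanImbrieJaffe1988, (5.2.3) p.278] -/
@[simp] theorem gevreyCutoff_χ₁ : gevreyCutoff.χ₁ = chi1 := rfl

/-- (5.2.4) for the witness: `χ(p, x) = chi1 (x/p)`. [cite: BalabanImbrieJaffe1988, (5.2.4) p.278] -/
theorem cutoff_gevreyCutoff (p x : ℝ) : cutoff gevreyCutoff p x = chi1 (x / p) := rfl

/-- **Non-vacuity of (5.2.3)**: a `C^∞` even function equal to `1` on `|x| ≤ 9/10`, to `0` on `|x| ≥ 1`, with `|χ^{(n)}| ≤ cⁿn^{cn}` for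
all `n`, `x`, EXISTS. [cite: BalabanImbrieJaffe1988, (5.2.3) p.278] -/
theorem cutoffProfile_nonempty : Nonempty CutoffProfile :=
  ⟨gevreyCutoff⟩

/-- The same as a bare existence statement over functions `ℝ → ℝ` (no reference to the structure).
[cite: BalabanImbrieJaffe1988, (5.2.3) p.278] -/
theorem exists_gevrey_cutoff :
    ∃ χ : ℝ → ℝ, (∀ x, χ (-x) = χ x) ∧ ContDiff ℝ (⊤ : ℕ∞) χ ∧ (∀ x, 1 ≤ |x| → χ x = 0) ∧ (∀ x, |x| ≤ 9 / 10 → χ x = 1) ∧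
      ∃ c : ℝ, ∀ (n : ℕ) (x : ℝ), |iteratedDeriv n χ x| ≤ c ^ n * (n : ℝ) ^ (c * n) :=
  ⟨chi1, chi1_neg, contDiff_chi1, fun _ hx => chi1_eq_zero hx, fun _ hx => chi1_eq_one hx, chi1_deriv_bound⟩

end Literature.MathematicalPhysics.QuantumFieldTheory.BalabanImbrieJaffe1984to88.BIJ88CutoffProfileWitness

end
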